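import Literature.Computation.Certificates.SemidefiniteRigorousBounds
import Mathlib.LinearAlgebra.AffineSpace.AffineMap
import Mathlib.LinearAlgebra.Pi
import Mathlib.Order.Interval.Set.Pi
import Mathlib.Data.Real.Basic
import Mathlib.Tactic.Linarith
import Mathlib.Tactic.Positivity
import Mathlib.Tactic.Ring
import HarnessLib

/-!
# Transfer of a FIXED dual certificate across a parameter cell: the first-order (Lipschitz) degradation
# law and which norm of the data derivative enters (Jansson–Chaykin–Keil bound, perturbed data)

Topic `Literature/Computation/Certificates` (joins `SemidefiniteRigorousBounds.lean` — the
Jansson–Chaykin–Keil a-posteriori bound `β − Σ_v ρ_v |r_v| − Σ_k |d_k⁻| τ_k` for EXACT data — and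
`SharedVaryingBoxCertificate.lean` — the VERTEX rule for certificates on a parameter box). Written for
the certified-numerics cell `certnum` (seat certnum-sdp-3, layer L2 "parametric / box certificates",
design note `run/shared/lean/pub/certnum/sdp/DESIGN-box.md` §2), serving the Hubbard box-dual lane
(hubbard-algo-p2 TARGET §16, hubbard-fast-p1 TARGET §3.3 "degradation model") and the chemistry
ladder's continuation certificates (LADDER-CHEM I-DIFF (b)). Everything is PROVED; no definition, no
named fact, no number.

## The question and the answer

A family of conic programs `P(θ)`, `θ` in a cell of `ℝ^κ`, whose DATA (objective, rows, right-hand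
sides, PSD entry forms) depend on `θ`; ONE dual point (multipliers `λ`, `κ ≥ 0`, PSD multipliers `Z`)
is certified at an anchor `θ₀`. Re-evaluated at another `θ` with the SAME multipliers, the rigorous
lower bound of Jansson–Chaykin–Keil (`SemidefiniteRigorousBounds`, `JanssonChaykinKeil.lmiForm_bound`
for the inequality/moment form, `theorem_3_2_traceBound` for the primal block form) degrades, and the
degradation is COMPUTABLE FROM THE CERTIFICATE ALONE (zero solves). Which norm of the data derivative
enters is dictated by the a-priori bound on the unknown primal object — it is the SUPPORT FUNCTION of
the a-priori set, i.e. the norm DUAL to it: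

* (moment / inequality form, a-priori box `|y_v| ≤ ρ_v`) the bound is `B(θ) = a(θ) − Σ_v ρ_v |ℓ_v(θ)|`
  with `a` (= `β`) and the residuals `ℓ_v` (= `r_v`) AFFINE in `θ` for fixed multipliers; then
  (`bound_anchor_sub_colNorm_le`)
  `B(θ) ≥ B(θ₀) + (a(θ) − a(θ₀)) − Σ_k |θ_k − θ₀,k| · P_k`,  `P_k := Σ_v ρ_v |∂_k ℓ_v|`
  — the `ρ`-WEIGHTED `ℓ¹` NORM of the `k`-th column of the residual Jacobian (for Hubbard moment words
  `ρ_v = 1`: the plain `ℓ¹` mass of the reduced `θ`-derivative of the residual polynomial, fast-p1's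
  `ρ_U`, `ρ_t′`); uniformly on a box of widths `h_k` containing the anchor,
  `B(θ) ≥ B(θ₀) − Σ_k h_k (|∂_k a| + P_k)` (`bound_anchor_sub_widths_le`), so ONE verified anchor value
  `m ≤ B(θ₀)` certifies `m − Σ_k h_k(|∂_k a| + P_k)` on the whole cell
  (`le_of_anchorCertificate_of_widths`, composed with the pointwise soundness of the bound formula);
* (primal block form, a-priori TRACE bounds `tr X_j ≤ τ_j`) the `θ`-dependence sits inside the
  eigen-shift: `D_j(θ) = C_j(θ) − Σ_i y_i A_ij(θ) = D_j(θ₀) + Σ_k (θ_k − θ₀,k) E_jk`; if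
  `D_j(θ₀) ⪰ d₀·1` and `−e_k·1 ⪯ E_k ⪯ e_k·1` (any certified bound `e_k ≥ ‖E_k‖₂`, e.g. the absolute
  row-sum bound of `Literature.Analysis.InnerProduct.CholeskyResidualEigenvalueBounds` /
  `…ValidatedNumerics.IntervalGershgorin.posSemidef_of_diagDominant`) then
  `D_j(θ) ⪰ (d₀ − Σ_k |θ_k − θ₀,k| e_k)·1` (`posSemidef_shiftTransfer`, Weyl's inequality in certificate
  form) and Lemma 3.1 gives `⟨D_j(θ), X⟩ ≥ (d₀ − Σ_k |Δθ_k| e_k) · tr X`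
  (`trace_mul_ge_of_shiftTransfer`): the TRACE BOUND × OPERATOR-NORM of `∂_k D_j` enters — not the
  Frobenius norm, not an entrywise norm.

The kernel behind both is one line of bookkeeping (`sub_le_of_lagrangianTransfer`): a Lagrangian
lower bound `m` on the a-priori domain at the anchor, plus a uniform bound `δ` on how much the
fixed-multiplier Lagrangian can drop between anchor and target on that domain, is a lower bound `m − δ`
for every feasible point of the target program (weak duality, Bertsekas Prop. 5.1.3, pointwise form).

## Honest framing (what this is NOT)

The Lipschitz law is WEAKER than the vertex rule of `SharedVaryingBoxCertificate` /
the Summits-side `…Transport.BoxCertificate.le_affine_sub_sum_abs_of_forall_boxVertices` (triangle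
inequality forfeits the sign cancellations between `ℓ_v(θ₀)` and `Δℓ_v`; the vertex rule evaluates
`|ℓ_v|` exactly at `2^κ` corners), but it needs NO vertex replay and yields its constant BEFORE the
cell is chosen — its uses are cell-size planning and dual SELECTION (among optimal anchor duals prefer
small `P_k`), and it is the only shape available when the data are merely Lipschitz (not affine) in
`θ`. Measured on Hubbard energy certificates the coupling-direction constants are large
(`P_U ≈ 1.4–4.3` per unit `U`, hubbard-fast-p1 TARGET §3.3 / algo-eng j240161: single-anchor transfer
is a spot-check device there, not a production box), while in the density and energy-cap directions
the transfer is of supporting-hyperplane quality. No strong duality, no existence of multipliers, no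
particular relaxation, no floating point: all data here are real numbers and the user instantiates
`a, ℓ_v, E_k` with the exact (rational) objects of a certificate.

## Mathlib / tree search

`SemidefiniteRigorousBounds` (JCK Lemma 3.1 `trace_mul_ge`, Thm 3.2, `lmiForm_bound`) gives the bound
at ONE data point; `SharedVaryingBoxCertificate` and the Summits-side `FixedDualBoxCertificate` give
the vertex rule (concavity of `B`); `Literature.Analysis.ValidatedNumerics.ParametricIntervalMatrixPosSemidef`
treats PSD-ness of an affine matrix family on a box by vertices (Hladík); none states the anchor +
derivative-norm form. Mathlib: `Matrix.PosSemidef.add/smul`, `Matrix.posSemidef_sum`,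
`LinearMap.pi_apply_eq_sum_univ`, `AffineMap.linearMap_vsub`, `Finset.abs_sum_le_sum_abs`; the trace step REUSES
`JanssonChaykinKeil.trace_mul_ge` (imported, not restated).

## References

* C. Jansson, D. Chaykin, C. Keil, *Rigorous error bounds for the optimal value in semidefinite
  programming*, SIAM J. Numer. Anal. 46 (2007/08) 180–200, Lemma 3.1 and Theorem 3.2 (the bound whose
  data are perturbed here; their interval version takes `inf` over a data box — the present file is the
  first-order enclosure of that `inf` for a fixed dual). [cite: JanssonChaykinKeil2008, Thm 3.2]
* R. A. Horn, C. R. Johnson, *Matrix Analysis*, 2nd ed., Cambridge 2013, Theorem 4.3.1 (Weyl) and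
  Cor. 6.1.5 / §5.6 (`ρ(E) ≤ ‖E‖_∞`). [cite: HornJohnson2013, Thm 4.3.1]
* D. P. Bertsekas, *Nonlinear Programming*, 2nd ed., Athena Scientific 1999, Prop. 5.1.3 (weak duality,
  pointwise form). [cite: Bertsekas1999NonlinearProgramming, Prop. 5.1.3]
-/

namespace Literature.Computation.Certificates.FixedDualTransfer

open Finset Matrix

/-! ### 1. Kernel: a Lagrangian lower bound transfers with the sup-defect of the Lagrangian -/

/-- **Transfer kernel** (weak duality, pointwise, with a perturbed Lagrangian). `F` = feasible set of
the TARGET program, `D` = a-priori domain, `c` = target objective, `pen ≥ 0` on `F` = the target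
program's penalty under the fixed multipliers (so `c − pen` is the target Lagrangian), `L₀` = the
anchor Lagrangian with the same multipliers. If `m ≤ L₀` on `D` (the verified anchor certificate) and
`L₀ − (c − pen) ≤ δ` on `D` (the computable degradation), then every target-feasible `y ∈ F ∩ D` has
`m − δ ≤ c y`. [cite: Bertsekas1999NonlinearProgramming, Prop. 5.1.3] -/
theorem sub_le_of_lagrangianTransfer {Y : Type*} (F D : Set Y) (c pen L₀ : Y → ℝ)
    (hpen : ∀ y ∈ F, 0 ≤ pen y) (m δ : ℝ) (hm : ∀ y ∈ D, m ≤ L₀ y)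
    (hδ : ∀ y ∈ D, L₀ y - (c y - pen y) ≤ δ) {y : Y} (hyF : y ∈ F) (hyD : y ∈ D) :
    m - δ ≤ c y := by
  have h1 := hm y hyD
  have h2 := hδ y hyD
  have h3 := hpen y hyF
  linarith

/-! ### 2. Moment / inequality form (a-priori box `|y_v| ≤ ρ_v`): the `ρ`-weighted `ℓ¹` column norm -/

section MomentForm

/-- **Anchor form of the bounded-variable bound, any parameter space** (no affinity needed): with
`B(θ) = a(θ) − Σ_{i∈s} ρ_i |ℓ_i(θ)|`, `ρ ≥ 0`,
`B(θ₀) + (a(θ) − a(θ₀)) − Σ_i ρ_i |ℓ_i(θ) − ℓ_i(θ₀)| ≤ B(θ)` (triangle inequality termwise). This is the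
Jansson–Chaykin–Keil bound `β − Σ_v ρ_v|r_v|` of `SemidefiniteRigorousBounds.JanssonChaykinKeil.lmiForm_bound`
read at perturbed data with the multipliers held fixed (`a = β`, `ℓ_v = r_v` as functions of the data; the
`θ`-independent eigen-shift term `−Σ_k |d_k⁻| τ_k` is folded into `a`).
[cite: JanssonChaykinKeil2008, Thm 3.2] -/
theorem bound_anchor_sub_abs_sub_le {X ι : Type*} (s : Finset ι) (a : X → ℝ) (ℓ : ι → X → ℝ)
    (ρ : ι → ℝ) (hρ : ∀ i ∈ s, 0 ≤ ρ i) (θ θ₀ : X) :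
    (a θ₀ - ∑ i ∈ s, ρ i * |ℓ i θ₀|) + (a θ - a θ₀) - ∑ i ∈ s, ρ i * |ℓ i θ - ℓ i θ₀|
      ≤ a θ - ∑ i ∈ s, ρ i * |ℓ i θ| := by
  have key : ∑ i ∈ s, ρ i * |ℓ i θ| ≤ ∑ i ∈ s, ρ i * |ℓ i θ₀| + ∑ i ∈ s, ρ i * |ℓ i θ - ℓ i θ₀| := by
    rw [← Finset.sum_add_distrib]
    refine Finset.sum_le_sum fun i hi => ?_
    rw [← mul_add]
    refine mul_le_mul_of_nonneg_left ?_ (hρ i hi)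
    have : ℓ i θ = ℓ i θ₀ + (ℓ i θ - ℓ i θ₀) := by ring
    calc |ℓ i θ| = |ℓ i θ₀ + (ℓ i θ - ℓ i θ₀)| := by rw [← this]
      _ ≤ |ℓ i θ₀| + |ℓ i θ - ℓ i θ₀| := abs_add_le _ _
  linarith

variable {κ : Type*} [Fintype κ] [DecidableEq κ]

/-- The increment of a real affine function on `ℝ^κ` is the Jacobian row applied to the parameter
increment: `ℓ θ − ℓ θ₀ = Σ_k (θ_k − θ₀,k) · ∂_k ℓ` with `∂_k ℓ := ℓ.linear (Pi.single k 1)`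
(`= ℓ(θ₀ + e_k) − ℓ(θ₀)`, computable exactly from the family's data) (plumbing). [folklore] -/
private theorem affineMap_sub_eq_sum_mul_partial (ℓ : (κ → ℝ) →ᵃ[ℝ] ℝ) (θ θ₀ : κ → ℝ) :
    ℓ θ - ℓ θ₀ = ∑ k, (θ k - θ₀ k) * ℓ.linear (Pi.single k 1) := by
  have h1 : ℓ θ - ℓ θ₀ = ℓ.linear (θ - θ₀) := by
    have := ℓ.linearMap_vsub θ θ₀
    simpa [vsub_eq_sub] using this.symm
  rw [h1, LinearMap.pi_apply_eq_sum_univ ℓ.linear (θ - θ₀)]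
  refine Finset.sum_congr rfl fun k _ => ?_
  rw [Pi.sub_apply, smul_eq_mul]
  congr 2
  funext j
  by_cases h : j = k
  · subst h; simp
  · simp [h, Ne.symm h]

/-- **Column-norm bound**: for affine residuals `ℓ_i` and weights `ρ_i ≥ 0`,
`Σ_i ρ_i |ℓ_i(θ) − ℓ_i(θ₀)| ≤ Σ_k |θ_k − θ₀,k| · P_k` with `P_k = Σ_i ρ_i |∂_k ℓ_i|` the `ρ`-weighted
`ℓ¹` norm of the `k`-th column of the residual Jacobian (plumbing; the public statement is
`bound_anchor_sub_colNorm_le`). [folklore] -/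
private theorem sum_mul_abs_sub_le_sum_abs_mul_colNorm {ι : Type*} (s : Finset ι)
    (ℓ : ι → (κ → ℝ) →ᵃ[ℝ] ℝ) (ρ : ι → ℝ) (hρ : ∀ i ∈ s, 0 ≤ ρ i) (θ θ₀ : κ → ℝ) :
    ∑ i ∈ s, ρ i * |ℓ i θ - ℓ i θ₀|
      ≤ ∑ k, |θ k - θ₀ k| * ∑ i ∈ s, ρ i * |(ℓ i).linear (Pi.single k 1)| := by
  have hterm : ∀ i ∈ s, ρ i * |ℓ i θ - ℓ i θ₀|
      ≤ ρ i * ∑ k, |θ k - θ₀ k| * |(ℓ i).linear (Pi.single k 1)| := by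
    intro i hi
    refine mul_le_mul_of_nonneg_left ?_ (hρ i hi)
    rw [affineMap_sub_eq_sum_mul_partial (ℓ i) θ θ₀]
    refine (Finset.abs_sum_le_sum_abs _ _).trans (le_of_eq ?_)
    exact Finset.sum_congr rfl fun k _ => abs_mul _ _
  refine (Finset.sum_le_sum hterm).trans (le_of_eq ?_)
  simp_rw [Finset.mul_sum]
  rw [Finset.sum_comm]
  refine Finset.sum_congr rfl fun k _ => Finset.sum_congr rfl fun i _ => by ring

/-- **The degradation law (moment / inequality form).** With affine `ℓ_i`, weights `ρ_i ≥ 0` and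
`P_k = Σ_i ρ_i |∂_k ℓ_i|` (the `ρ`-weighted `ℓ¹` column norm of the residual Jacobian),
`B(θ₀) + (a(θ) − a(θ₀)) − Σ_k |θ_k − θ₀,k| P_k ≤ B(θ)` where `B(θ) = a(θ) − Σ_i ρ_i |ℓ_i(θ)|`: a fixed
dual's Jansson–Chaykin–Keil bound degrades at most linearly, at rate `P_k` per unit of `θ_k`, plus the
exact (signed) change of the affine head `a`. Here `∂_k ℓ_i := (ℓ i).linear (Pi.single k 1)`, which a
reader computes as the exact finite difference `ℓ_i(θ₀ + e_k) − ℓ_i(θ₀)` of the certificate's residual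
map (two evaluations, zero solves). This is the first-order enclosure, for ONE fixed dual, of the
`inf` over a data box in the interval-data version of the source's Theorem 3.2.
[cite: JanssonChaykinKeil2008, Thm 3.2] -/
theorem bound_anchor_sub_colNorm_le {ι : Type*} (s : Finset ι) (a : (κ → ℝ) → ℝ)
    (ℓ : ι → (κ → ℝ) →ᵃ[ℝ] ℝ) (ρ : ι → ℝ) (hρ : ∀ i ∈ s, 0 ≤ ρ i) (θ θ₀ : κ → ℝ) :
    (a θ₀ - ∑ i ∈ s, ρ i * |ℓ i θ₀|) + (a θ - a θ₀)
        - ∑ k, |θ k - θ₀ k| * ∑ i ∈ s, ρ i * |(ℓ i).linear (Pi.single k 1)|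
      ≤ a θ - ∑ i ∈ s, ρ i * |ℓ i θ| := by
  have h1 := bound_anchor_sub_abs_sub_le s a (fun i θ => ℓ i θ) ρ hρ θ θ₀
  have h2 := sum_mul_abs_sub_le_sum_abs_mul_colNorm s ℓ ρ hρ θ θ₀
  linarith

/-- **Fully linearised form** (affine head `a` as well): with `g_k = ∂_k a`,
`B(θ₀) − Σ_k |θ_k − θ₀,k| (|g_k| + P_k) ≤ B(θ)`. [cite: JanssonChaykinKeil2008, Thm 3.2] -/
theorem bound_anchor_sub_lipschitz_le {ι : Type*} (s : Finset ι) (a : (κ → ℝ) →ᵃ[ℝ] ℝ)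
    (ℓ : ι → (κ → ℝ) →ᵃ[ℝ] ℝ) (ρ : ι → ℝ) (hρ : ∀ i ∈ s, 0 ≤ ρ i) (θ θ₀ : κ → ℝ) :
    (a θ₀ - ∑ i ∈ s, ρ i * |ℓ i θ₀|)
        - ∑ k, |θ k - θ₀ k| * (|a.linear (Pi.single k 1)| + ∑ i ∈ s, ρ i * |(ℓ i).linear (Pi.single k 1)|)
      ≤ a θ - ∑ i ∈ s, ρ i * |ℓ i θ| := by
  have h1 := bound_anchor_sub_colNorm_le s a ℓ ρ hρ θ θ₀
  have h2 : -(∑ k, |θ k - θ₀ k| * |a.linear (Pi.single k 1)|) ≤ a θ - a θ₀ := by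
    rw [affineMap_sub_eq_sum_mul_partial a θ θ₀, ← Finset.sum_neg_distrib]
    refine Finset.sum_le_sum fun k _ => ?_
    rw [← abs_mul]
    exact neg_abs_le _
  have h3 : ∑ k, |θ k - θ₀ k| * (|a.linear (Pi.single k 1)| + ∑ i ∈ s, ρ i * |(ℓ i).linear (Pi.single k 1)|)
      = ∑ k, |θ k - θ₀ k| * |a.linear (Pi.single k 1)|
        + ∑ k, |θ k - θ₀ k| * ∑ i ∈ s, ρ i * |(ℓ i).linear (Pi.single k 1)| := by
    rw [← Finset.sum_add_distrib]
    exact Finset.sum_congr rfl fun k _ => by ring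
  linarith

omit [Fintype κ] [DecidableEq κ] in
/-- On a coordinate box, two points differ coordinatewise by at most the widths:
`θ, θ₀ ∈ Set.Icc lo hi ⇒ |θ_k − θ₀,k| ≤ hi_k − lo_k` (plumbing). [folklore] -/
private theorem abs_sub_le_width_of_mem_Icc {lo hi θ θ₀ : κ → ℝ} (hθ : θ ∈ Set.Icc lo hi)
    (hθ₀ : θ₀ ∈ Set.Icc lo hi) (k : κ) : |θ k - θ₀ k| ≤ hi k - lo k := by
  rw [abs_sub_le_iff]
  exact ⟨by linarith [hθ.2 k, hθ₀.1 k], by linarith [hθ₀.2 k, hθ.1 k]⟩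

/-- **Uniform degradation on a box containing the anchor**: for `θ, θ₀ ∈ Set.Icc lo hi`,
`B(θ₀) − Σ_k (hi_k − lo_k)(|∂_k a| + P_k) ≤ B(θ)`. One anchor evaluation and the constants
`|∂_k a|, P_k` (computable from the certificate, zero solves) bound the fixed dual's value on the whole
cell. [cite: JanssonChaykinKeil2008, Thm 3.2] -/
theorem bound_anchor_sub_widths_le {ι : Type*} (s : Finset ι) (a : (κ → ℝ) →ᵃ[ℝ] ℝ)
    (ℓ : ι → (κ → ℝ) →ᵃ[ℝ] ℝ) (ρ : ι → ℝ) (hρ : ∀ i ∈ s, 0 ≤ ρ i) {lo hi θ θ₀ : κ → ℝ}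
    (hθ : θ ∈ Set.Icc lo hi) (hθ₀ : θ₀ ∈ Set.Icc lo hi) :
    (a θ₀ - ∑ i ∈ s, ρ i * |ℓ i θ₀|)
        - ∑ k, (hi k - lo k) * (|a.linear (Pi.single k 1)| + ∑ i ∈ s, ρ i * |(ℓ i).linear (Pi.single k 1)|)
      ≤ a θ - ∑ i ∈ s, ρ i * |ℓ i θ| := by
  have h1 := bound_anchor_sub_lipschitz_le s a ℓ ρ hρ θ θ₀
  have h2 : ∑ k, |θ k - θ₀ k| * (|a.linear (Pi.single k 1)| + ∑ i ∈ s, ρ i * |(ℓ i).linear (Pi.single k 1)|)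
      ≤ ∑ k, (hi k - lo k) * (|a.linear (Pi.single k 1)| + ∑ i ∈ s, ρ i * |(ℓ i).linear (Pi.single k 1)|) := by
    refine Finset.sum_le_sum fun k _ => mul_le_mul_of_nonneg_right (abs_sub_le_width_of_mem_Icc hθ hθ₀ k) ?_
    exact add_nonneg (abs_nonneg _) (Finset.sum_nonneg fun i hi => mul_nonneg (hρ i hi) (abs_nonneg _))
  linarith

/-- **Box certificate from ONE anchor (Lipschitz shape).** Programs `P(θ)` with feasible sets `F θ`
and objective `obj y θ`; suppose the bound formula is pointwise sound on the cell —
`a(θ) − Σ_i ρ_i|ℓ_i(θ)| ≤ obj y θ` for every `θ` in the box and every `y ∈ F θ` (this is what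
`JanssonChaykinKeil.lmiForm_bound`, resp. a certificate reader, supplies at each `θ` for the FIXED
multipliers) — and the anchor value is verified, `m ≤ a(θ₀) − Σ_i ρ_i|ℓ_i(θ₀)|`. Then
`m − Σ_k (hi_k − lo_k)(|∂_k a| + P_k) ≤ obj y θ` for every `θ ∈ Set.Icc lo hi` and every `y ∈ F θ`.
[cite: JanssonChaykinKeil2008, Thm 3.2] -/
theorem le_of_anchorCertificate_of_widths {ι Y : Type*} (s : Finset ι) (a : (κ → ℝ) →ᵃ[ℝ] ℝ)
    (ℓ : ι → (κ → ℝ) →ᵃ[ℝ] ℝ) (ρ : ι → ℝ) (hρ : ∀ i ∈ s, 0 ≤ ρ i) {lo hi : κ → ℝ}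
    (F : (κ → ℝ) → Set Y) (obj : Y → (κ → ℝ) → ℝ)
    (hsound : ∀ θ ∈ Set.Icc lo hi, ∀ y ∈ F θ, a θ - ∑ i ∈ s, ρ i * |ℓ i θ| ≤ obj y θ)
    {θ₀ : κ → ℝ} (hθ₀ : θ₀ ∈ Set.Icc lo hi) (m : ℝ) (hm : m ≤ a θ₀ - ∑ i ∈ s, ρ i * |ℓ i θ₀|)
    {θ : κ → ℝ} (hθ : θ ∈ Set.Icc lo hi) {y : Y} (hy : y ∈ F θ) :
    m - ∑ k, (hi k - lo k) * (|a.linear (Pi.single k 1)| + ∑ i ∈ s, ρ i * |(ℓ i).linear (Pi.single k 1)|)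
      ≤ obj y θ := by
  have h1 := bound_anchor_sub_widths_le s a ℓ ρ hρ hθ hθ₀
  have h2 := hsound θ hθ y hy
  linarith

end MomentForm

/-! ### 3. Primal block form (a-priori trace bounds): operator-norm degradation of the eigen-shift -/

section BlockForm

variable {n : Type*} [DecidableEq n]

/-- **Signed scaling of a two-sided operator-norm bound**: if `−e·1 ⪯ E ⪯ e·1` (stated as
`e·1 − E ⪰ 0` and `e·1 + E ⪰ 0`; any certified `e ≥ ‖E‖₂`) then `|t|·e·1 + t·E ⪰ 0` for every real `t`.
[cite: HornJohnson2013, Thm 4.3.1] -/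
theorem posSemidef_abs_mul_smul_one_add_smul {E : Matrix n n ℝ} {e : ℝ}
    (hm : (e • (1 : Matrix n n ℝ) - E).PosSemidef) (hp : (e • (1 : Matrix n n ℝ) + E).PosSemidef)
    (t : ℝ) : ((|t| * e) • (1 : Matrix n n ℝ) + t • E).PosSemidef := by
  rcases le_or_gt 0 t with ht | ht
  · have h := hp.smul ht
    rw [abs_of_nonneg ht]
    convert h using 1
    rw [smul_add, smul_smul]
  · have h := hm.smul (neg_nonneg.2 ht.le)
    rw [abs_of_neg ht]
    convert h using 1
    rw [smul_sub, smul_smul, neg_smul, sub_neg_eq_add]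

/-- **Eigen-shift transfer (Weyl's inequality in certificate form).** If the anchor dual slack
satisfies `D₀ ⪰ d₀·1` and each data-derivative direction obeys `−e_k·1 ⪯ E_k ⪯ e_k·1` (`k ∈ s`), then
for all increments `t`, `D₀ + Σ_k t_k E_k ⪰ (d₀ − Σ_k |t_k| e_k)·1`: the certified `λ_min` shift
degrades by at most `Σ_k |t_k| e_k`, the OPERATOR norms of the derivative blocks (the quantity dual
to a trace bound on the unknown primal block). [cite: HornJohnson2013, Thm 4.3.1] -/
theorem posSemidef_shiftTransfer {K : Type*} (s : Finset K) {D₀ : Matrix n n ℝ} {d₀ : ℝ}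
    (h₀ : (D₀ - d₀ • (1 : Matrix n n ℝ)).PosSemidef) (E : K → Matrix n n ℝ) (e : K → ℝ)
    (hE : ∀ k ∈ s, (e k • (1 : Matrix n n ℝ) - E k).PosSemidef ∧
      (e k • (1 : Matrix n n ℝ) + E k).PosSemidef)
    (t : K → ℝ) :
    ((D₀ + ∑ k ∈ s, t k • E k) - (d₀ - ∑ k ∈ s, |t k| * e k) • (1 : Matrix n n ℝ)).PosSemidef := by
  have hsum : (∑ k ∈ s, ((|t k| * e k) • (1 : Matrix n n ℝ) + t k • E k)).PosSemidef :=
    Matrix.posSemidef_sum s fun k hk =>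
      posSemidef_abs_mul_smul_one_add_smul (hE k hk).1 (hE k hk).2 (t k)
  have h := h₀.add hsum
  convert h using 1
  rw [Finset.sum_add_distrib, ← Finset.sum_smul, sub_smul]
  abel

/-- **Lemma 3.1 at transferred data.** With `D₀ ⪰ d₀·1`, `−e_k·1 ⪯ E_k ⪯ e_k·1` and `X ⪰ 0`:
`(d₀ − Σ_k |t_k| e_k) · tr X ≤ ⟨D₀ + Σ_k t_k E_k, X⟩`. Combined with a trace bound `tr X ≤ τ` this is
the per-block term of Jansson–Chaykin–Keil's Theorem 3.2 (`SemidefiniteRigorousBounds.JanssonChaykinKeil.theorem_3_2_traceBound`)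
for the dual slack of the program at `θ = θ₀ + t` with the anchor's multipliers: the degradation of the
bound is `τ × Σ_k |t_k| e_k`. [cite: JanssonChaykinKeil2008, Lemma 3.1] -/
theorem trace_mul_ge_of_shiftTransfer [Fintype n] {K : Type*} (s : Finset K) {D₀ X : Matrix n n ℝ} {d₀ : ℝ}
    (h₀ : (D₀ - d₀ • (1 : Matrix n n ℝ)).PosSemidef) (E : K → Matrix n n ℝ) (e : K → ℝ)
    (hE : ∀ k ∈ s, (e k • (1 : Matrix n n ℝ) - E k).PosSemidef ∧
      (e k • (1 : Matrix n n ℝ) + E k).PosSemidef)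
    (t : K → ℝ) (hX : X.PosSemidef) :
    (d₀ - ∑ k ∈ s, |t k| * e k) * trace X ≤ trace ((D₀ + ∑ k ∈ s, t k • E k) * X) := by
  -- Jansson–Chaykin–Keil Lemma 3.1 (trace form, `SemidefiniteRigorousBounds`) at the transferred shift
  exact JanssonChaykinKeil.trace_mul_ge (posSemidef_shiftTransfer s h₀ E e hE t) hX

/-- **Uniform eigen-shift on a box containing the anchor**: for `θ, θ₀ ∈ Set.Icc lo hi`,
`D₀ + Σ_k (θ_k − θ₀,k) E_k ⪰ (d₀ − Σ_k (hi_k − lo_k) e_k)·1` — one verified anchor shift `d₀` and the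
derivative norms `e_k` give a valid shift on the whole cell (feed it to Theorem 3.2 as `d_j`).
[cite: HornJohnson2013, Thm 4.3.1] -/
theorem posSemidef_shiftTransfer_of_mem_Icc {κ : Type*} [Fintype κ] {D₀ : Matrix n n ℝ} {d₀ : ℝ}
    (h₀ : (D₀ - d₀ • (1 : Matrix n n ℝ)).PosSemidef) (E : κ → Matrix n n ℝ) (e : κ → ℝ)
    (hE : ∀ k, (e k • (1 : Matrix n n ℝ) - E k).PosSemidef ∧ (e k • (1 : Matrix n n ℝ) + E k).PosSemidef)
    {lo hi θ θ₀ : κ → ℝ} (hθ : θ ∈ Set.Icc lo hi) (hθ₀ : θ₀ ∈ Set.Icc lo hi) :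
    ((D₀ + ∑ k, (θ k - θ₀ k) • E k) - (d₀ - ∑ k, (hi k - lo k) * e k) • (1 : Matrix n n ℝ)).PosSemidef := by
  have h1 := posSemidef_shiftTransfer Finset.univ h₀ E e (fun k _ => hE k) (fun k => θ k - θ₀ k)
  -- the widths dominate the increments, and `e_k ≥ 0` (from `−e_k·1 ⪯ E_k ⪯ e_k·1` when `n` is nonempty;
  -- in general from the two PSD hypotheses' sum `2 e_k·1 ⪰ 0` only if `n` is nonempty, so we argue via
  -- the difference being a nonnegative multiple of `1` when nonempty and trivially otherwise)
  have hgap : ((∑ k, (hi k - lo k) * e k - ∑ k, |θ k - θ₀ k| * e k) • (1 : Matrix n n ℝ)).PosSemidef := by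
    rcases isEmpty_or_nonempty n with hn | hn
    · exact ⟨by simp [Matrix.IsHermitian], fun x => by simp [Subsingleton.elim x 0]⟩
    · have he : ∀ k, 0 ≤ e k := by
        intro k
        obtain ⟨i⟩ := hn
        have h2 := ((hE k).1.add (hE k).2).diag_nonneg (i := i)
        simp only [Matrix.add_apply, Matrix.sub_apply, Matrix.smul_apply, Matrix.one_apply_eq,
          smul_eq_mul, mul_one] at h2
        linarith
      refine Matrix.PosSemidef.one.smul ?_
      rw [← Finset.sum_sub_distrib]
      exact Finset.sum_nonneg fun k _ => by
        rw [← sub_mul]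
        exact mul_nonneg (sub_nonneg.2 (abs_sub_le_width_of_mem_Icc hθ hθ₀ k)) (he k)
  have h := h1.add hgap
  convert h using 1
  rw [sub_smul, sub_smul, sub_smul]
  abel

end BlockForm

end Literature.Computation.Certificates.FixedDualTransfer
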